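import Summits.NavierStokesRegularity.TurbBounds.ShearForm
import Summits.NavierStokesRegularity.TurbBounds.ShearCoupling
import Summits.NavierStokesRegularity.TurbBounds.ShearTripleGaunt
import Summits.NavierStokesRegularity.TurbBounds.ShearBridgeNorms
import Mathlib.Analysis.Calculus.ContDiff.Polynomial
import HarnessLib

/-!
# The bridge: the relaxed form `G_m{W}` of a POLYNOMIAL pair equals the certificates' tracked quadratic forms + Parseval tails − D·(E-forms + tail
# cross term) — the right-hand side of `Certs/<Row>/ModeForm<m>.modeForm_nonneg` (rbsdp SPEC 2.3–2.7, generic `(N, P)`)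
(cell `pub-turb` / `turb-bounds`, shear lane; v2 item V2-BRIDGE, written by pub-turb-shear gen 7, 2026-08-22. Depends on the tree + the staged shear
chain `ShearSpecPieces … ShearBridgeNorms` (gen 6, manifest Ca) + this generation's `ShearForm`, `ShearCoupling`, `ShearTripleGaunt`.)

HONEST FRAMING: rigorous bounds for the stated PDE and boundary conditions; no claim about physical turbulence beyond the bound.
PROVED (generic `N, P`, constants `A, C, D : ℚ`, profile derivative `g = Σ_{p≤P} ĝ_p P_p`, polynomials `U, V` with `U(−1) = U′(−1) = 0 = V(−1) = V′(−1)`,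
any window length `L > deg U, deg V`; `c_i, a_i, b_i` = Legendre coefficients of `W_i″, W_i′, W_i`):
* `sum_bform_eTab_eq_xFin`: `Σ_p ĝ_p·c₁ᵀE⁽ᵖ⁾c₂ = xFin N P g b₁ a₂` — the literal cross-term tables of the evaluator (`eTab = D0cᵀK⁽ᵖ⁾D1`, entries
  `triple m' n p` on FW16's set `S`) ARE the exact tracked part of `∫ g·V′·U` (`ShearSpecQForms.bform_eTab` + ladder dictionary + `ShearTripleGaunt` +
  `ShearCoupling.lam3_expansion`);
* **`shearForm_poly_decomp`**: `shearForm A C D g U V = (c₁ᵀQ1c₁ + c₂ᵀQ1c₂) + (A·ΣT2 + 8·ΣT1 + C·ΣT0) − D·(Σ_p ĝ_p (c₁ᵀE⁽ᵖ⁾c₂ − c₂ᵀE⁽ᵖ⁾c₁) + X_t)`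
  with `X_t = tailX N P g U V = ∫ g·(ṽ₁ũ₀ − ũ₁ṽ₀)` — literally the expression bounded below by `ModeForm<m>.modeForm_nonneg`;
* **`tailX_bound`**: `|g| ≤ T` on `[−1,1]`, `δ > 0` ⇒ `|X_t| ≤ T·((δ/2)(Σ_{k<L} w b₁² + Σ w b₂²)|_{N+1} + (Σ w a₁² + Σ w a₂²)|_{N+2}/(2δ))` — the
  hypothesis `hX` of `modeForm_nonneg`;
* row-independent dictionaries: `Acell_cast/Ccell_cast/Dcell_cast` (the cell constants of `ShearForm` = casts of generator C's `Am/Cm/Dm`), `delta_cast_pos`,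
  `wall_data` (ladders + far-wall relation of a polynomial component with `W(±1) = 0`, `W′(−1) = 0`).
-/

set_option linter.style.longLine false

noncomputable section

namespace Summit.NavierStokesRegularity.TurbBounds.ShearPolyBridge

open Polynomial intervalIntegral MeasureTheory Set Finset Literature.Analysis.SpecialFunctions
open Summit.NavierStokesRegularity.TurbBounds.LadderTail (w w_pos IsLadder)
open Summit.NavierStokesRegularity.TurbBounds.LegendreCoeffs
open Summit.NavierStokesRegularity.TurbBounds.ShearForm
open Summit.NavierStokesRegularity.TurbBounds.ShearCoupling
open Summit.NavierStokesRegularity.TurbBounds.ShearTripleGaunt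
open Summit.NavierStokesRegularity.TurbBounds.ShearSpecPieces

/-- The profile derivative as a polynomial from its Legendre data: `g = Σ_{p ≤ P} ĝ_p P_p`. -/
def gpOf (P : ℕ) (ghat : ℕ → ℝ) : ℝ[X] := ∑ p ∈ range (P + 1), C (ghat p) * legendre p

/-- `deg g ≤ P`. -/
theorem natDegree_gpOf_le (P : ℕ) (ghat : ℕ → ℝ) : (gpOf P ghat).natDegree ≤ P := by
  unfold gpOf
  refine natDegree_sum_le_of_forall_le _ _ fun p hp => ?_
  have hp' : p ≤ P := by have := mem_range.mp hp; omega
  exact (natDegree_C_mul_le _ _).trans ((natDegree_legendre p).le.trans hp')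

/-- The tail cross term `X_t = ∫ g·(ṽ₁ũ₀ − ũ₁ṽ₀)` of the pair `(U, V)` (tails `ũ₀ = tailFrom (N+1) U`, `ũ₁ = tailFrom (N+2) U′`, …). -/
def tailX (N P : ℕ) (ghat : ℕ → ℝ) (Up Vp : ℝ[X]) : ℝ :=
  ∫ x in (-1 : ℝ)..1, (gpOf P ghat).eval x * ((tailFrom (N + 2) (derivative Vp)).eval x * (tailFrom (N + 1) Up).eval x
    - (tailFrom (N + 2) (derivative Up)).eval x * (tailFrom (N + 1) Vp).eval x)

/-! ## 0. Row-independent dictionaries used by every `Results/<Row>Poly` file -/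

/-- The cell constant `A_m` is the cast of generator C's `Am Γx π_hi m`. -/
theorem Acell_cast (Gx : ℚ) (m : ℕ) : Acell (Gx : ℝ) m = ((Am Gx (5419351 / 1725033) m : ℚ) : ℝ) := by
  unfold Acell Am; push_cast; ring

/-- The cell constant `C_m` is the cast of `Cm Γx π_lo m` (for a row whose recorded `π_lo` is the cell's). -/
theorem Ccell_cast (Gx piLo : ℚ) (hlo : piLo = 4272943 / 1360120) (m : ℕ) : Ccell (Gx : ℝ) m = ((Cm Gx piLo m : ℚ) : ℝ) := by
  subst hlo; unfold Ccell Cm; push_cast; ring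

/-- The cell constant `D_m` is the cast of `Dm Γx π_lo m`. -/
theorem Dcell_cast (Gx piLo : ℚ) (hlo : piLo = 4272943 / 1360120) (m : ℕ) : Dcell (Gx : ℝ) m = ((Dm Gx piLo m : ℚ) : ℝ) := by
  subst hlo; unfold Dcell Dm; push_cast; ring

/-- `δ_N = delta N > 0` (cast). -/
theorem delta_cast_pos (N : ℕ) : (0 : ℝ) < ((delta N : ℚ) : ℝ) := by
  unfold delta; push_cast; positivity

/-- Wall bookkeeping for a polynomial component with `W(±1) = 0`, `W′(−1) = 0`: the ladders `ĉ(W″) → ĉ(W′) → ĉ(W)` with the `x = −1`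
relations, and the far-wall relation `ĉ₀(W″) = ĉ₁(W″)/3` (rbsdp SPEC 2.8: `W(1) = 0 ⇔ ĉ₀(W′) = 0`, via `LegendreCoeffs.eval_one_eq`). -/
theorem wall_data (Wp : ℝ[X]) (h0 : Wp.eval (-1) = 0) (h1 : (derivative Wp).eval (-1) = 0) (h2 : Wp.eval 1 = 0) :
    IsLadder (legCoeff (derivative (derivative Wp))) (legCoeff (derivative Wp))
      ∧ legCoeff (derivative Wp) 0 = legCoeff (derivative (derivative Wp)) 0 - legCoeff (derivative (derivative Wp)) 1 / 3
      ∧ IsLadder (legCoeff (derivative Wp)) (legCoeff Wp)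
      ∧ legCoeff (derivative (derivative Wp)) 0 = legCoeff (derivative (derivative Wp)) 1 / 3 := by
  have hA := isLadder_legCoeff (derivative Wp) h1
  have h0a := legCoeff_zero_of_wall (derivative Wp) h1
  have hB := isLadder_legCoeff Wp h0
  have ha0 : legCoeff (derivative Wp) 0 = 0 := by
    have h := eval_one_eq Wp h0
    rw [h2] at h
    linarith
  refine ⟨hA, h0a, hB, ?_⟩
  rw [ha0] at h0a
  linarith

/-! ## 1. The literal cross-term tables are the exact tracked part -/

/-- **`Σ_p ĝ_p·c₁ᵀE⁽ᵖ⁾c₂ = xFin N P g b₁ a₂`** for ladders `c₁ → a₁ → b₁` (both wall relations) and `c₂ → a₂` (first wall relation). -/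
theorem sum_bform_eTab_eq_xFin (N P : ℕ) (ghat : ℕ → ℝ) {c₁ a₁ b₁ c₂ a₂ : ℕ → ℝ}
    (hA₁ : IsLadder c₁ a₁) (h0a₁ : a₁ 0 = c₁ 0 - c₁ 1 / 3) (hB₁ : IsLadder a₁ b₁) (h0b₁ : b₁ 0 = a₁ 0 - a₁ 1 / 3)
    (hA₂ : IsLadder c₂ a₂) (h0a₂ : a₂ 0 = c₂ 0 - c₂ 1 / 3) :
    ∑ p ∈ range (P + 1), ghat p * bform (eTab N P p) (N + P + 4) c₁ c₂ = xFin N P (gpOf P ghat) b₁ a₂ := by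
  have step : ∀ p, bform (eTab N P p) (N + P + 4) c₁ c₂
      = ∑ n ∈ range (N + P + 2), ∑ m' ∈ range (N + P + 3), (get2 (kTab N P p) n m' : ℝ) * b₁ n * a₂ m' := by
    intro p
    rw [bform_eTab]
    refine sum_congr rfl fun n hn => sum_congr rfl fun m' hm' => ?_
    rw [lin_d0cRows_eq_ladder hA₁ h0a₁ hB₁ h0b₁ n (mem_range.mp hn), lin_d1Rows_eq_ladder hA₂ h0a₂ m' (mem_range.mp hm')]
  simp_rw [step, Finset.mul_sum]
  rw [Finset.sum_comm]
  unfold xFin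
  refine sum_congr rfl fun n hn => ?_
  rw [Finset.sum_comm]
  refine sum_congr rfl fun m' hm' => ?_
  have hn' := mem_range.mp hn
  have hm'' := mem_range.mp hm'
  by_cases hS : inS N P n m'
  · have hS' : (m' ≤ N + 1 ∧ n ≤ N + P + 1) ∨ (N + 2 ≤ m' ∧ m' ≤ N + P ∧ n ≤ N) := hS
    rw [if_pos hS]
    simp only [get2_kTab, if_pos (And.intro hn' hm''), if_pos hS', triple_cast_eq_integral']
    unfold gpOf
    rw [lam3_expansion, sum_mul, sum_mul]
    exact sum_congr rfl fun p _ => by ring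
  · have hS' : ¬((m' ≤ N + 1 ∧ n ≤ N + P + 1) ∨ (N + 2 ≤ m' ∧ m' ≤ N + P ∧ n ≤ N)) := hS
    rw [if_neg hS]
    simp only [get2_kTab, if_pos (And.intro hn' hm''), if_neg hS', Rat.cast_zero, zero_mul, mul_zero, sum_const_zero]

/-! ## 2. Window bookkeeping -/

/-- Shrinking a coefficient window whose extra entries vanish. -/
theorem window_shrink (f : ℕ → ℝ) (t L d : ℕ) (hf : ∀ j, t + L ≤ j → f j = 0) :
    ∑ k ∈ range (L + d), w (t + k) * f (t + k) ^ 2 = ∑ k ∈ range L, w (t + k) * f (t + k) ^ 2 := by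
  rw [sum_range_add]
  have hz : ∑ k ∈ range d, w (t + (L + k)) * f (t + (L + k)) ^ 2 = 0 :=
    sum_eq_zero fun k _ => by rw [hf _ (by omega)]; ring
  rw [hz, add_zero]

/-- Legendre coefficients vanish beyond the degree (window form). -/
theorem legCoeff_zero_beyond (F : ℝ[X]) {L : ℕ} (hL : F.natDegree < L) (t : ℕ) : ∀ j, t + L ≤ j → legCoeff F j = 0 :=
  fun j hj => legCoeff_eq_zero_of_lt F (by omega)

/-! ## 3. The decomposition of the relaxed form of a polynomial pair -/

/-- **The bridge identity** (see the file header). -/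
theorem shearForm_poly_decomp (N P : ℕ) (A C D : ℚ) (ghat : ℕ → ℝ) (Up Vp : ℝ[X])
    (hU0 : Up.eval (-1) = 0) (hU1 : (derivative Up).eval (-1) = 0) (hV0 : Vp.eval (-1) = 0) (hV1 : (derivative Vp).eval (-1) = 0)
    (L : ℕ) (hLU : Up.natDegree < L) (hLV : Vp.natDegree < L) :
    shearForm (A : ℝ) (C : ℝ) (D : ℝ) (fun x => (gpOf P ghat).eval x) (fun x => Up.eval x) (fun x => Vp.eval x)
      = (qform (q1Tab N P A C) (N + P + 4) (legCoeff (derivative (derivative Up)))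
          + qform (q1Tab N P A C) (N + P + 4) (legCoeff (derivative (derivative Vp))))
        + ((A : ℝ) * (∑ k ∈ range L, w (N + P + 4 + k) * legCoeff (derivative (derivative Up)) (N + P + 4 + k) ^ 2
              + ∑ k ∈ range L, w (N + P + 4 + k) * legCoeff (derivative (derivative Vp)) (N + P + 4 + k) ^ 2)
           + 8 * (∑ k ∈ range L, w (N + 2 + k) * legCoeff (derivative Up) (N + 2 + k) ^ 2
              + ∑ k ∈ range L, w (N + 2 + k) * legCoeff (derivative Vp) (N + 2 + k) ^ 2)
           + (C : ℝ) * (∑ k ∈ range L, w (N + 1 + k) * legCoeff Up (N + 1 + k) ^ 2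
              + ∑ k ∈ range L, w (N + 1 + k) * legCoeff Vp (N + 1 + k) ^ 2))
        - (D : ℝ) * ((∑ p ∈ range (P + 1), ghat p * (bform (eTab N P p) (N + P + 4) (legCoeff (derivative (derivative Up))) (legCoeff (derivative (derivative Vp)))
              - bform (eTab N P p) (N + P + 4) (legCoeff (derivative (derivative Vp))) (legCoeff (derivative (derivative Up)))))
            + tailX N P ghat Up Vp) := by
  -- derivatives of polynomial functions
  have dU : deriv (fun x => Up.eval x) = fun x => (derivative Up).eval x := by funext x; exact Polynomial.deriv Up
  have dU1 : deriv (fun x => (derivative Up).eval x) = fun x => (derivative (derivative Up)).eval x := by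
    funext x; exact Polynomial.deriv (derivative Up)
  have dV : deriv (fun x => Vp.eval x) = fun x => (derivative Vp).eval x := by funext x; exact Polynomial.deriv Vp
  have dV1 : deriv (fun x => (derivative Vp).eval x) = fun x => (derivative (derivative Vp)).eval x := by
    funext x; exact Polynomial.deriv (derivative Vp)
  -- polynomial functions are `C²` (kept local: a generic top-level copy would be a near-duplicate, decision 120 (C))
  have hU2 : ContDiff ℝ 2 (fun x => Up.eval x) := by simpa using Polynomial.contDiff_aeval (𝕜 := ℝ) Up 2
  have hV2 : ContDiff ℝ 2 (fun x => Vp.eval x) := by simpa using Polynomial.contDiff_aeval (𝕜 := ℝ) Vp 2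
  rw [shearForm_eq (A : ℝ) (C : ℝ) (D : ℝ) (gpOf P ghat).continuous hU2 hV2]
  simp only [dU, dU1, dV, dV1]
  -- split the three norm integrals
  have i2 : ∀ q : ℝ[X], IntervalIntegrable (fun x => q.eval x ^ 2) volume (-1 : ℝ) 1 := fun q => Continuous.intervalIntegrable (by fun_prop) _ _
  rw [intervalIntegral.integral_add (i2 _) (i2 _), intervalIntegral.integral_add (i2 _) (i2 _), intervalIntegral.integral_add (i2 _) (i2 _)]
  -- norm splits (windows of the larger parameter L' = N+P+4+L)
  have hdU : (derivative Up).natDegree < L := lt_of_le_of_lt (natDegree_derivative_le Up) (lt_of_le_of_lt (Nat.sub_le _ _) hLU)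
  have hdV : (derivative Vp).natDegree < L := lt_of_le_of_lt (natDegree_derivative_le Vp) (lt_of_le_of_lt (Nat.sub_le _ _) hLV)
  have hU := norms_split N P A C Up hU0 hU1 (N + P + 4 + L) (by omega) (by omega)
  have hV := norms_split N P A C Vp hV0 hV1 (N + P + 4 + L) (by omega) (by omega)
  rw [show N + P + 4 + L - (N + P + 4) = L by omega, show N + P + 4 + L - (N + 2) = L + (P + 2) by omega,
    show N + P + 4 + L - (N + 1) = L + (P + 3) by omega,
    window_shrink _ (N + 2) L (P + 2) (legCoeff_zero_beyond _ hdU _), window_shrink _ (N + 1) L (P + 3) (legCoeff_zero_beyond _ hLU _)] at hU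
  rw [show N + P + 4 + L - (N + P + 4) = L by omega, show N + P + 4 + L - (N + 2) = L + (P + 2) by omega,
    show N + P + 4 + L - (N + 1) = L + (P + 3) by omega,
    window_shrink _ (N + 2) L (P + 2) (legCoeff_zero_beyond _ hdV _), window_shrink _ (N + 1) L (P + 3) (legCoeff_zero_beyond _ hLV _)] at hV
  -- the cross term
  have hX := coupling_split_pair N P (gpOf P ghat) Up Vp (natDegree_gpOf_le P ghat)
  -- ladders of the coefficient sequences (wall relations at x = -1)
  have hA₁ : IsLadder (legCoeff (derivative (derivative Up))) (legCoeff (derivative Up)) := isLadder_legCoeff (derivative Up) hU1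
  have h0a₁ := legCoeff_zero_of_wall (derivative Up) hU1
  have hB₁ : IsLadder (legCoeff (derivative Up)) (legCoeff Up) := isLadder_legCoeff Up hU0
  have h0b₁ := legCoeff_zero_of_wall Up hU0
  have hA₂ : IsLadder (legCoeff (derivative (derivative Vp))) (legCoeff (derivative Vp)) := isLadder_legCoeff (derivative Vp) hV1
  have h0a₂ := legCoeff_zero_of_wall (derivative Vp) hV1
  have hB₂ : IsLadder (legCoeff (derivative Vp)) (legCoeff Vp) := isLadder_legCoeff Vp hV0
  have h0b₂ := legCoeff_zero_of_wall Vp hV0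
  have hfin₁ := sum_bform_eTab_eq_xFin N P ghat hA₁ h0a₁ hB₁ h0b₁ hA₂ h0a₂
  have hfin₂ := sum_bform_eTab_eq_xFin N P ghat hA₂ h0a₂ hB₂ h0b₂ hA₁ h0a₁
  have hfin : ∑ p ∈ range (P + 1), ghat p * (bform (eTab N P p) (N + P + 4) (legCoeff (derivative (derivative Up))) (legCoeff (derivative (derivative Vp)))
        - bform (eTab N P p) (N + P + 4) (legCoeff (derivative (derivative Vp))) (legCoeff (derivative (derivative Up))))
      = xFin N P (gpOf P ghat) (legCoeff Up) (legCoeff (derivative Vp)) - xFin N P (gpOf P ghat) (legCoeff Vp) (legCoeff (derivative Up)) := by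
    rw [← hfin₁, ← hfin₂, ← sum_sub_distrib]
    exact sum_congr rfl fun p _ => by ring
  unfold tailX
  rw [hfin]
  linear_combination hU + hV - (D : ℝ) * hX

/-! ## 4. The Young bound on the tail cross term in window form -/

/-- **`|X_t| ≤ T·((δ/2)(Σ w b₁² + Σ w b₂²) + (Σ w a₁² + Σ w a₂²)/(2δ))`** with windows of length `L` from `N+1` (for `b = ĉ(W)`) and `N+2`
(for `a = ĉ(W′)`), whenever `|g| ≤ T` on `[−1, 1]`, `δ > 0` and `L > deg U, deg V`. -/
theorem tailX_bound (N P : ℕ) (ghat : ℕ → ℝ) (Up Vp : ℝ[X]) {T : ℝ} (hT : ∀ x ∈ Icc (-1 : ℝ) 1, |(gpOf P ghat).eval x| ≤ T)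
    (L : ℕ) (hLU : Up.natDegree < L) (hLV : Vp.natDegree < L) {δ : ℝ} (hδ : 0 < δ) :
    |tailX N P ghat Up Vp|
      ≤ T * (δ / 2 * (∑ k ∈ range L, w (N + 1 + k) * legCoeff Up (N + 1 + k) ^ 2 + ∑ k ∈ range L, w (N + 1 + k) * legCoeff Vp (N + 1 + k) ^ 2)
          + (∑ k ∈ range L, w (N + 2 + k) * legCoeff (derivative Up) (N + 2 + k) ^ 2
              + ∑ k ∈ range L, w (N + 2 + k) * legCoeff (derivative Vp) (N + 2 + k) ^ 2) / (2 * δ)) := by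
  have hdU : (derivative Up).natDegree < L := lt_of_le_of_lt (natDegree_derivative_le Up) (lt_of_le_of_lt (Nat.sub_le _ _) hLU)
  have hdV : (derivative Vp).natDegree < L := lt_of_le_of_lt (natDegree_derivative_le Vp) (lt_of_le_of_lt (Nat.sub_le _ _) hLV)
  have h := coupling_tail_young (g := fun x => (gpOf P ghat).eval x) (u0 := fun x => (tailFrom (N + 1) Up).eval x)
    (u1 := fun x => (tailFrom (N + 2) (derivative Up)).eval x) (v0 := fun x => (tailFrom (N + 1) Vp).eval x)
    (v1 := fun x => (tailFrom (N + 2) (derivative Vp)).eval x)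
    (gpOf P ghat).continuous (Polynomial.continuous _) (Polynomial.continuous _) (Polynomial.continuous _) (Polynomial.continuous _) hT hδ
  rw [integral_tailFrom_sq (N + 1) Up (L := L) (by omega), integral_tailFrom_sq (N + 1) Vp (L := L) (by omega),
    integral_tailFrom_sq (N + 2) (derivative Up) (L := L) (by omega), integral_tailFrom_sq (N + 2) (derivative Vp) (L := L) (by omega)] at h
  unfold tailX
  exact h

end Summit.NavierStokesRegularity.TurbBounds.ShearPolyBridge

end
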